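import Literature.MathematicalPhysics.QuantumFieldTheory.Balaban1983to89.B9Eq310DeltaPrime
import Literature.MathematicalPhysics.QuantumFieldTheory.Balaban1983to89.B9Eq310Hermitian

/-!
# `Balaban1983to89.B9Eq310DeltaPrimeJunction` — T. Bałaban, *Propagators for lattice gauge theories in a background field*, Commun. Math.
# Phys. **99** (1985) 389–434 [Balaban1985BackgroundPropagators], (3.10) p. 392 with (3.1)–(3.2) p. 390, (3.4)/(3.7) p. 391, (3.12) p. 392:
# THE JUNCTION BETWEEN THE TREE'S TWO TYPINGS OF THE CURVATURE FORM `Δ′` AND THE HESSIAN FORM `Δ = D*D + Δ′` — `B9Eq310DeltaPrime`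
# (bilinear forms `curvForm`/`hessForm` on `𝔤ᶜ`-valued bond functions of the periodic carrier `B9SectCLatticeCarrier`, 2026-08-21) and
# `B9Eq39Adjoint`/`B9Eq310Hermitian` (`deltaPrime`/`hessPair`/`deltaPrimeOp` on the abstract shift model `(S, ι, T, U)`, 2026-08-19, with the
# PROVED expansion `eq312` = (3.12)): on the periodic carrier the two agree identically, and hence the Hessian form of `B9Eq310DeltaPrime` IS
# the exact second variation of the Wilson action

statement-level skeleton of published theorems with citation tags; proofs where landed; nothing here is a claim
about the Yang–Mills mass gap

PDF held: `paper:balaban1985-cmp99-background-propagators` (journal page = PDF page + 388); the verbatim texts of (3.1)–(3.2), (3.4), (3.7),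
(3.10) are quoted in `B9Eq310DeltaPrime` (read as images from the cell's renders) and of (3.12) in `B9Eq39Adjoint`.

THE PRINT (p. 392, as quoted in `B9Eq310DeltaPrime`).  *«⟨A,Δ′A⟩ = Σ_{p⊂T_η} η^d tr((D¹_U A)(p))²η⁻²(Re U(∂p) − 1) + tr Σ_{b₁,b₂⊂∂(p)_z, b₁≺b₂}
i[A′(b₁),A′(b₂)]η⁻² Im U(∂p)»* (3.10); and (3.12) *«A^η(U′U) = A^η(U) + ⟨A, J⟩ + ½⟨A, ΔA⟩ + …»* (the expansion of the Wilson action to second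
order around the background, `B9Eq39Adjoint.eq312`).

WHY THIS FILE (cell context).  The reading of record C-ne9leaf04g61-1 (pub-balaban `GAPS.md`) of `B9Eq310DeltaPrime` found that the tree
already held (3.10) in the abstract shift model — `B9Eq39Adjoint.deltaPrime` (the diagonal form), `hessPair` (`⟨A, D*DA⟩ + ⟨A, Δ′A⟩`),
`B9Eq310Hermitian.deltaPrimeOp` (Δ′ as an operator, symmetric in the trace pairing, `*`-equivariant, bounded) and `B9Eq39Adjoint.eq312`
(the exact expansion (3.12)) — without either file naming the other (DOCFIX-1, DEDUP/JUNCTION).  On the NE9 owner's word (W-ne9p1-g78-2,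
2026-08-21) this proof-only file records the junction: the dictionary `T μ := shiftEquiv μ`, `U μ x := U (x, μ)`, `A μ x := A (x, μ)`
(written INLINE — no new definition) carries `plaqHolU`, `reHol`/`imHol`, the four edge letters in the order `≺`, the curl, and the sums
over plaquettes onto pv27's letters, and the forms agree.  Consumers of either typing may now move results across BY NAME (e.g. the
operator `curvOp` of `B9Eq310HessianOperator`, extracted from `curvForm` by Riesz, is `deltaPrimeOp` in the trace pairing — `curvForm_eq_bondPair_deltaPrimeOp`).

WHAT IS PROVED (sorry-free; no definition; no inequality of the paper).
* §1 dictionary identities: `plaqHolU_eq_plaqU` (`rfl`), `reHol_eq_reC`, `imHol_eq_imC` (`B9Eq37Insertion.reC`/`imC`), `lettersA_eq_edgeLin`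
  (pv27's `lettersA` = `[edgeLin 0, edgeLin 1, edgeLin 2, edgeLin 3]`, SAME order `≺`), `curl_eq_covCurl`, `curlAt_eq_curlη` (the owner's
  `curlAt η⁻¹` = pv27's `curlη` = print's `(D^η_U A)(p)`); private plumbing `sum_posPlaq_eq_sum_plaq` (pv27's `Σ_{q ∈ posPlaq}` =
  `Σ_{p : Plaq d Pd}`) and `smul_mul_smul_mul`.
* §2 `orderedPairs_sum_eq_commSum` — `Σ_{kl ∈ orderedPairs} i[a_k, a_l] = i • commSum [a₀, a₁, a₂, a₃]` (`Beta.TransportVertices.commSum`).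
* §3 THE JUNCTION: **`curvForm_self_eq_deltaPrime`** — `curvForm τ η U A A = deltaPrime T U η d τ A` for EVERY linear `τ` (same `η^d`, same
  reading `D¹ = ηD^η`, same `≺`, same complexified `Re`/`Im`, same holonomy); **`curvForm_eq_bondPair_deltaPrimeOp`** (tracial `τ`) — the
  polarization is pv27's operator pairing `⟨A, Δ′_op B⟩`; **`hessForm_self_eq_hessPair`** (tracial `τ`); **`action_expansion_hessForm`**
  (tracial `τ`, `η ≠ 0`, `4 ≤ d`) — `A^η(U′U₀) = A^η(U₀) + ⟨A, J⟩ + ½·hessForm τ η U A A + η^{d−4} Σ_p ρ_p`, i.e. `eq312` BY NAME: the owner's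
  Hessian form is the exact second variation of the Wilson action.
* §4 `curvForm_self_comm` — at a commutative fibre (`𝔸 = ℂ`, `τ = id`) the commutator block vanishes: `⟨A, Δ′A⟩ = Σ_p η^d (D^ηA)(p)²(Re U(∂p) − 1)`.
MODEL / DECLARED READINGS.  As the two imported files: periodic carrier `TSite d Pd`, positively oriented plaquettes `p_{μν}(x)`, `μ < ν`;
`𝔸 ⊇ 𝔤ᶜ` a complex (normed, where pv27's letters ask it) algebra; `τ` a linear datum, TRACIAL where stated (print: the normalized trace).
The commutator letter is order-sensitive (`commSum [a,b,c,e] − commSum [b,a,c,e] = 2(ab − ba)`), so §3 pins the owner's `≺` to pv27's = print's.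
HONEST SCOPE.  [folklore] algebra between two encodings of the same printed objects; no estimate of the paper («bounded, small operator»,
Sect. B–E) asserted, instantiated or discharged; NOT summit progress (cell pub-balaban: NE9 NOT PRINTED / NOT PROVED; spine PROVED 0/9).
Filed by the pub-balaban NE9 leaf lineage `b2b-balaban-t4-ne9-formalise-leaf-04` (gen 63; junction lemmas from the gen-61 reading probe) on
the NE9 BINDER-row owner's word W-ne9p1-g78-2; a NEW proof-only file importing `B9Eq310DeltaPrime` and `B9Eq310Hermitian`; nothing modified.
Net new unproved facts: 0.
-/

open scoped BigOperators
open Complex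

namespace Literature.MathematicalPhysics.QuantumFieldTheory.Balaban1983to89.B9Eq310DeltaPrimeJunction

open B9SectCLatticeCarrier (Bond DirPair shift unshift)
open B9Eq33CovDerivVector (adTransport shiftEquiv)
open B4Sect5Torus (TSite)
open B9Eq310DeltaPrime (plaqHolU reHol imHol edgeLin edgeLin_zero edgeLin_one edgeLin_two edgeLin_three curlAt curlAt_apply orderedPairs
  curvForm curvForm_apply_self curvForm_symm hessForm hessForm_apply)

/-! ## §1 The dictionary `T μ := shiftEquiv μ`, `U μ x := U (x, μ)`, `A μ x := A (x, μ)` (inline) and the letter identities -/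

section Dictionary

variable {d : ℕ} {Pd : Fin d → ℕ} {𝔸 : Type*} [Ring 𝔸] [Algebra ℂ 𝔸]

omit [Algebra ℂ 𝔸] in
/-- The plaquette holonomy `U(∂p)` of `B9Eq310DeltaPrime` IS pv27's `B9Eq39Adjoint.plaqU` read through the dictionary (and B8's `plaqHol`,
`B9Eq310DeltaPrime.plaqHolU_eq_plaqHol`) — by `rfl` ([B9] (3.1) p. 390: `U₀(∂p)`, the holonomy of the background around `∂(p)_z`).
[cite: Balaban1985BackgroundPropagators, (3.1) p.390] -/
theorem plaqHolU_eq_plaqU (U : Bond d Pd → 𝔸ˣ) (x : TSite d Pd) (q : DirPair d) :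
    plaqHolU U (x, q) = B9Eq39Adjoint.plaqU (fun μ => shiftEquiv μ) (fun μ y => U (y, μ)) q.1.1 q.1.2 x := rfl

/-- `Re U(∂p)` of `B9Eq310DeltaPrime` IS pv27's complexified real part `B9Eq37Insertion.reC` of the holonomy ([B9] p. 391
«Re U₀(∂p) = ½(U₀(∂p) + U₀(−∂p))»). [cite: Balaban1985BackgroundPropagators, (3.7) p.391] -/
theorem reHol_eq_reC (U : Bond d Pd → 𝔸ˣ) (p : B9SectCLatticeCarrier.Plaq d Pd) :
    reHol U p = B9Eq37Insertion.reC (plaqHolU U p) := by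
  rw [B9Eq310DeltaPrime.reHol, B9Eq37Insertion.reC, one_div]

/-- `Im U(∂p)` of `B9Eq310DeltaPrime` IS pv27's `B9Eq37Insertion.imC` («Im U₀(∂p) = (1/2i)(U₀(∂p) − U₀(−∂p))»).
[cite: Balaban1985BackgroundPropagators, (3.7) p.391] -/
theorem imHol_eq_imC (U : Bond d Pd → 𝔸ˣ) (p : B9SectCLatticeCarrier.Plaq d Pd) :
    imHol U p = B9Eq37Insertion.imC (plaqHolU U p) := by
  rw [B9Eq310DeltaPrime.imHol, B9Eq37Insertion.imC_eq, neg_div]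

/-- **The four transported edge variables `A′(b)`, `b ⊂ ∂(p)_z`, IN THE ORDER `≺`** of `B9Eq310DeltaPrime.edgeLin` ARE pv27's
`B9Eq39Adjoint.lettersA` (print's `∂(p)_z = ⟨z,w⟩∪⟨w,x⟩∪⟨x,y⟩∪⟨y,z⟩`, same signs). [cite: Balaban1985BackgroundPropagators, (3.2) p.390] -/
theorem lettersA_eq_edgeLin (U : Bond d Pd → 𝔸ˣ) (A : Bond d Pd → 𝔸) (x : TSite d Pd) (q : DirPair d) :
    B9Eq39Adjoint.lettersA (fun μ => shiftEquiv μ) (fun μ y => U (y, μ)) (fun μ y => A (y, μ)) q.1.1 q.1.2 x =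
      [edgeLin U (x, q) 0 A, edgeLin U (x, q) 1 A, edgeLin U (x, q) 2 A, edgeLin U (x, q) 3 A] := by
  rw [edgeLin_zero, edgeLin_one, edgeLin_two, edgeLin_three]
  rfl

/-- The `c`-scaled covariant curl of `B9Eq34CovCurlVector` is `c •` the unit-lattice curl. [cite: Balaban1985BackgroundPropagators, (3.4) p.391] -/
theorem covCurl_smul_one (c : ℂ) (R : Bond d Pd → 𝔸 →ₗ[ℂ] 𝔸) (A : Bond d Pd → 𝔸) (p : B9SectCLatticeCarrier.Plaq d Pd) :
    B9Eq34CovCurlVector.covCurl c R A p = c • B9Eq34CovCurlVector.covCurl (1 : ℂ) R A p := by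
  obtain ⟨x, q⟩ := p
  rw [B9Eq34CovCurlVector.covCurl_apply_coord, B9Eq34CovCurlVector.covCurl_apply_coord, one_smul, one_smul]
  simp only [smul_sub]

/-- pv27's unit-lattice curl `B9Eq39Adjoint.curl` through the dictionary = `B9Eq34CovCurlVector.covCurl 1 (adTransport U)`.
[cite: Balaban1985BackgroundPropagators, (3.4) p.391] -/
theorem curl_eq_covCurl (U : Bond d Pd → 𝔸ˣ) (A : Bond d Pd → 𝔸) (x : TSite d Pd) (q : DirPair d) :
    B9Eq39Adjoint.curl (fun μ => shiftEquiv μ) (fun μ y => U (y, μ)) (fun μ y => A (y, μ)) q.1.1 q.1.2 x =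
      B9Eq34CovCurlVector.covCurl (1 : ℂ) (adTransport (𝕜 := ℂ) U) A (x, q) := by
  rw [B9Eq34CovCurlVector.covCurl_adTransport_apply]
  simp only [B9Eq39Adjoint.curl, B9Eq39Adjoint.covD, B9Eq39Adjoint.R_def, shiftEquiv, Equiv.coe_fn_mk, one_smul]

/-- **`(D^η_U A)(p)`: `B9Eq310DeltaPrime.curlAt η⁻¹` IS pv27's `B9Eq39Adjoint.curlη`** through the dictionary.
[cite: Balaban1985BackgroundPropagators, (3.4) p.391] -/
theorem curlAt_eq_curlη (η : ℝ) (U : Bond d Pd → 𝔸ˣ) (A : Bond d Pd → 𝔸) (x : TSite d Pd) (q : DirPair d) :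
    curlAt ((η : ℂ))⁻¹ U (x, q) A =
      B9Eq39Adjoint.curlη (fun μ => shiftEquiv μ) (fun μ y => U (y, μ)) η (fun μ y => A (y, μ)) q.1.1 q.1.2 x := by
  rw [curlAt_apply, B9Eq39Adjoint.curlη, curl_eq_covCurl, ← covCurl_smul_one]

/-- Reindexing pv27's `Σ_{q ∈ posPlaq}` (triples `(x, μ, ν)` with `μ < ν`) as the sum over the carrier's positively oriented plaquettes
`Plaq d Pd = TSite × DirPair` (private plumbing for §3). [folklore] -/
private theorem sum_posPlaq_eq_sum_plaq {M : Type*} [AddCommMonoid M] (g : TSite d Pd → Fin d → Fin d → M) :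
    ∑ q ∈ B9Eq39Adjoint.posPlaq (TSite d Pd) (Fin d), g q.1 q.2.1 q.2.2 = ∑ p : B9SectCLatticeCarrier.Plaq d Pd, g p.1 p.2.1.1 p.2.1.2 := by
  rw [Fintype.sum_prod_type, B9Eq39Adjoint.posPlaq, Finset.sum_filter, Fintype.sum_prod_type]
  refine Finset.sum_congr rfl fun x _ => ?_
  rw [← Finset.sum_filter]
  exact (Finset.sum_subtype (Finset.univ.filter fun q : Fin d × Fin d => q.1 < q.2) (by intro q; simp)
    (fun q : Fin d × Fin d => g x q.1 q.2))

end Dictionary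

/-! ## §2 The commutator block -/

section Commutator

variable {𝔸 : Type*} [NormedRing 𝔸] [NormedAlgebra ℂ 𝔸]

/-- **`Σ_{kl ∈ orderedPairs} i[a_k, a_l] = i • commSum [a₀, a₁, a₂, a₃]`** — the commutator block of (3.10) in `B9Eq310DeltaPrime`'s
spelling IS `Beta.TransportVertices.commSum` (pv27's letter) of the four edge letters. [cite: Balaban1985BackgroundPropagators, (3.10) p.392] -/
theorem orderedPairs_sum_eq_commSum (v : Fin 4 → 𝔸) :
    ∑ kl ∈ orderedPairs, I • (v kl.1 * v kl.2 - v kl.2 * v kl.1) = I • Beta.TransportVertices.commSum [v 0, v 1, v 2, v 3] := by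
  rw [← Finset.smul_sum]
  congr 1
  rw [B9Eq310DeltaPrime.orderedPairs, Finset.sum_filter, Fintype.sum_prod_type, Beta.TransportVertices.commSum_four]
  simp only [Fin.sum_univ_four]
  simp (config := { decide := true }) only [if_true, if_false]
  norm_num
  abel

/-- The same at the letters `v k := edgeLin U p k A` (first-order form, for `rw`). [cite: Balaban1985BackgroundPropagators, (3.10) p.392] -/
theorem orderedPairs_sum_edgeLin_eq_commSum {d : ℕ} {Pd : Fin d → ℕ} (U : Bond d Pd → 𝔸ˣ) (p : B9SectCLatticeCarrier.Plaq d Pd)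
    (A : Bond d Pd → 𝔸) :
    ∑ kl ∈ orderedPairs, I • (edgeLin U p kl.1 A * edgeLin U p kl.2 A - edgeLin U p kl.2 A * edgeLin U p kl.1 A) =
      I • Beta.TransportVertices.commSum [edgeLin U p 0 A, edgeLin U p 1 A, edgeLin U p 2 A, edgeLin U p 3 A] :=
  orderedPairs_sum_eq_commSum (fun k => edgeLin U p k A)

/-- `(aX)(aX)Y = XX(a²•Y)` (moving the scalar `η⁻¹` of `D^η` onto the holonomy factor, print's `tr((D¹A)(p))²η⁻²`; private plumbing
for §3). [folklore] -/
private theorem smul_mul_smul_mul (a : ℂ) (X Y : 𝔸) : (a • X) * (a • X) * Y = X * X * ((a ^ 2) • Y) := by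
  simp only [smul_mul_assoc, mul_smul_comm, smul_smul, pow_two]

end Commutator

/-! ## §3 THE JUNCTION: `curvForm` ↔ `deltaPrime` / `deltaPrimeOp`, `hessForm` ↔ `hessPair`, and (3.12) by name -/

section Junction

variable {d : ℕ} {Pd : Fin d → ℕ} {𝔸 : Type*} [NormedRing 𝔸] [NormedAlgebra ℂ 𝔸]

/-- **THE DIAGONAL JUNCTION: `B9Eq310DeltaPrime`'s (3.10) IS pv27's (3.10)** — on the periodic carrier, through the inline dictionary,
`curvForm τ η U A A = B9Eq39Adjoint.deltaPrime T U η d τ A` for EVERY linear `τ`, every `η`, `U`, `A` (same weight `η^d`, same reading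
`D¹ = ηD^η`, same order `≺`, same complexified `Re`/`Im`, same holonomy based at `x`). [cite: Balaban1985BackgroundPropagators, (3.10) p.392] -/
theorem curvForm_self_eq_deltaPrime (τ : 𝔸 →ₗ[ℂ] ℂ) (η : ℝ) (U : Bond d Pd → 𝔸ˣ) (A : Bond d Pd → 𝔸) :
    curvForm τ η U A A =
      B9Eq39Adjoint.deltaPrime (fun μ => shiftEquiv μ) (fun μ y => U (y, μ)) η d τ (fun μ y => A (y, μ)) := by
  rw [curvForm_apply_self, B9Eq39Adjoint.deltaPrime, Finset.mul_sum,
    sum_posPlaq_eq_sum_plaq (fun x μ ν => ((η : ℂ)) ^ d *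
      (τ (B9Eq39Adjoint.curl (fun μ => shiftEquiv μ) (fun μ y => U (y, μ)) (fun μ y => A (y, μ)) μ ν x *
            B9Eq39Adjoint.curl (fun μ => shiftEquiv μ) (fun μ y => U (y, μ)) (fun μ y => A (y, μ)) μ ν x *
          ((((η : ℂ)⁻¹) ^ 2) • (B9Eq37Insertion.reC
            (B9Eq39Adjoint.plaqU (fun μ => shiftEquiv μ) (fun μ y => U (y, μ)) μ ν x) - 1)))
        + τ ((I • Beta.TransportVertices.commSum
            (B9Eq39Adjoint.lettersA (fun μ => shiftEquiv μ) (fun μ y => U (y, μ)) (fun μ y => A (y, μ)) μ ν x)) *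
          ((((η : ℂ)⁻¹) ^ 2) • B9Eq37Insertion.imC
            (B9Eq39Adjoint.plaqU (fun μ => shiftEquiv μ) (fun μ y => U (y, μ)) μ ν x)))))]
  refine Finset.sum_congr rfl fun p _ => ?_
  obtain ⟨x, q⟩ := p
  rw [orderedPairs_sum_edgeLin_eq_commSum, ← lettersA_eq_edgeLin, reHol_eq_reC, imHol_eq_imC, plaqHolU_eq_plaqU, curlAt_eq_curlη,
    B9Eq39Adjoint.curlη, smul_mul_smul_mul]

/-- **THE POLAR JUNCTION (tracial `τ`): `B9Eq310DeltaPrime`'s polarization IS pv27's operator pairing** `⟨A, Δ′_op B⟩ =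
bondPair A (deltaPrimeOp B)` — so the operator `B9Eq310HessianOperator.curvOp`, extracted from `curvForm` by Riesz against the trace
pairing, is `B9Eq310Hermitian.deltaPrimeOp` there (from the diagonal junction at `A + B`, `curvForm_symm`, bilinearity and pv27's
`deltaPrime_add`; `2 ≠ 0` in `ℂ`). [cite: Balaban1985BackgroundPropagators, (3.10) p.392] -/
theorem curvForm_eq_bondPair_deltaPrimeOp (τ : 𝔸 →ₗ[ℂ] ℂ) (hτ : ∀ a b : 𝔸, τ (a * b) = τ (b * a)) (η : ℝ)
    (U : Bond d Pd → 𝔸ˣ) (A B : Bond d Pd → 𝔸) :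
    curvForm τ η U A B =
      B9Eq39Adjoint.bondPair η d τ (fun μ y => A (y, μ))
        (B9Eq310Hermitian.deltaPrimeOp (fun μ => shiftEquiv μ) (fun μ y => U (y, μ)) η (fun μ y => B (y, μ))) := by
  have h := curvForm_self_eq_deltaPrime τ η U (A + B)
  simp only [map_add, LinearMap.add_apply] at h
  rw [curvForm_self_eq_deltaPrime, curvForm_self_eq_deltaPrime, curvForm_symm τ η U B A,
    show (fun (μ : Fin d) (y : TSite d Pd) => (A + B) (y, μ)) = (fun μ y => A (y, μ)) + (fun μ y => B (y, μ)) from rfl,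
    B9Eq310Hermitian.deltaPrime_add (fun μ => shiftEquiv μ) (fun μ y => U (y, μ)) τ hτ] at h
  have h2 : (2 : ℂ) * curvForm τ η U A B =
      2 * B9Eq39Adjoint.bondPair η d τ (fun μ y => A (y, μ))
        (B9Eq310Hermitian.deltaPrimeOp (fun μ => shiftEquiv μ) (fun μ y => U (y, μ)) η (fun μ y => B (y, μ))) := by
    linear_combination h
  exact mul_left_cancel₀ two_ne_zero h2

/-- **THE HESSIAN JUNCTION (tracial `τ`)**: `B9Eq310DeltaPrime.hessForm` on the diagonal IS pv27's `B9Eq39Adjoint.hessPair =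
⟨A, D*DA⟩ + ⟨A, Δ′A⟩` ((3.10) «⟨A,ΔA⟩ = ⟨A,D*DA⟩ + ⟨A,Δ′A⟩», via pv27's summation by parts `bondPair_divPη_curlη`).
[cite: Balaban1985BackgroundPropagators, (3.10) p.392] -/
theorem hessForm_self_eq_hessPair (τ : 𝔸 →ₗ[ℂ] ℂ) (hτ : ∀ a b : 𝔸, τ (a * b) = τ (b * a)) (η : ℝ) (U : Bond d Pd → 𝔸ˣ)
    (A : Bond d Pd → 𝔸) :
    hessForm τ η U A A = B9Eq39Adjoint.hessPair (fun μ => shiftEquiv μ) (fun μ y => U (y, μ)) η d τ (fun μ y => A (y, μ)) := by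
  rw [hessForm_apply, curvForm_self_eq_deltaPrime, B9Eq39Adjoint.hessPair,
    B9Eq39Adjoint.bondPair_divPη_curlη (fun μ => shiftEquiv μ) (fun μ y => U (y, μ)) τ hτ, Finset.mul_sum,
    sum_posPlaq_eq_sum_plaq (fun x μ ν => ((η : ℂ)) ^ d *
      τ (B9Eq39Adjoint.curlη (fun μ => shiftEquiv μ) (fun μ y => U (y, μ)) η (fun μ y => A (y, μ)) μ ν x *
        B9Eq39Adjoint.curlη (fun μ => shiftEquiv μ) (fun μ y => U (y, μ)) η (fun μ y => A (y, μ)) μ ν x))]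
  congr 1
  refine Finset.sum_congr rfl fun p _ => ?_
  obtain ⟨x, q⟩ := p
  rw [curlAt_eq_curlη]

variable [CompleteSpace 𝔸]

/-- **`B9Eq310DeltaPrime`'s HESSIAN FORM IS THE SECOND VARIATION OF THE WILSON ACTION** — pv27's `B9Eq39Adjoint.eq312` ((3.12), EXACT
background, arbitrary units, tracial `τ`, `η ≠ 0`, `4 ≤ d`) BY NAME through `hessForm_self_eq_hessPair`:
`A^η(U′U₀) = A^η(U₀) + ⟨A, J⟩ + ½·hessForm τ η U A A + η^{d−4}·Σ_p ρ_p`. [cite: Balaban1985BackgroundPropagators, (3.12) p.392] -/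
theorem action_expansion_hessForm (τ : 𝔸 →ₗ[ℂ] ℂ) (hτ : ∀ a b : 𝔸, τ (a * b) = τ (b * a)) (η : ℝ) (hη : η ≠ 0) (hd : 4 ≤ d)
    (U : Bond d Pd → 𝔸ˣ) (A : Bond d Pd → 𝔸) :
    B9Eq39Adjoint.action (fun μ => shiftEquiv μ) η d τ
        (B9Eq39Adjoint.prodCfg (fun μ y => (U (y, μ) : 𝔸ˣ)) η (fun μ y => A (y, μ))) =
      B9Eq39Adjoint.action (fun μ => shiftEquiv μ) η d τ (fun μ y => U (y, μ))
        + B9Eq39Adjoint.bondPair η d τ (fun μ y => A (y, μ)) (B9Eq39Adjoint.J (fun μ => shiftEquiv μ) (fun μ y => U (y, μ)) η)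
        + 2⁻¹ * hessForm τ η U A A
        + (η : ℂ) ^ (d - 4) * ∑ q ∈ B9Eq39Adjoint.posPlaq (TSite d Pd) (Fin d),
            B9Eq39Adjoint.rem3 (fun μ => shiftEquiv μ) (fun μ y => U (y, μ)) η τ (fun μ y => A (y, μ)) q.2.1 q.2.2 q.1 := by
  rw [hessForm_self_eq_hessPair τ hτ]
  exact B9Eq39Adjoint.eq312 (fun μ => shiftEquiv μ) (fun μ y => U (y, μ)) τ hτ η hη hd (fun μ y => A (y, μ))

end Junction

/-! ## §4 Sanity: the commutative fibre -/

section Sanity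

variable {d : ℕ} {Pd : Fin d → ℕ}

/-- At a commutative fibre (`𝔸 = ℂ`, `τ = id`) the commutator block of (3.10) vanishes identically and `⟨A, Δ′A⟩ =
Σ_p η^d (D^ηA)(p)²(Re U(∂p) − 1)` — the Abelian lattice gauge theory's curvature correction («generalizing the operator ∂*∂ in the
Abelian case», p. 392). [cite: Balaban1985BackgroundPropagators, (3.10) p.392] -/
theorem curvForm_self_comm (η : ℝ) (U : Bond d Pd → ℂˣ) (A : Bond d Pd → ℂ) :
    curvForm (LinearMap.id : ℂ →ₗ[ℂ] ℂ) η U A A =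
      ∑ p : B9SectCLatticeCarrier.Plaq d Pd, ((η : ℂ)) ^ d * (curlAt ((η : ℂ))⁻¹ U p A * curlAt ((η : ℂ))⁻¹ U p A * (reHol U p - 1)) := by
  rw [curvForm_apply_self]
  refine Finset.sum_congr rfl fun p _ => ?_
  simp [mul_comm]

end Sanity

end Literature.MathematicalPhysics.QuantumFieldTheory.Balaban1983to89.B9Eq310DeltaPrimeJunction
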